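import Summits.AtomisticToContinuum.Crystallization.Theses.PhononSlackCertificates
import Summits.AtomisticToContinuum.Crystallization.Theorems.ReggeStarCoercivityDefectFreeCrystallizesSqueezeToLayeredA
import Summits.AtomisticToContinuum.Crystallization.Theorems.ReggeStarCoercivityStarCoercivityTwoShellGoodStarGood
import Summits.AtomisticToContinuum.Crystallization.Theorems.PhononSlackCertificatesHullBridgeWindows
import Summits.AtomisticToContinuum.Crystallization.Theorems.PhononSlackCertificatesHullBridgeBadFraction
import Summits.AtomisticToContinuum.Crystallization.Theorems.PhononSlackCertificatesHullBridgeNonLayeredFraction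
import Summits.AtomisticToContinuum.Crystallization.Theorems.PhononSlackCertificatesHullBridgeCleanCentres
import Summits.AtomisticToContinuum.Crystallization.Theorems.PhononSlackCertificatesHullBridgeWindowsOfGluing
import Summits.AtomisticToContinuum.Crystallization.Theorems.ReggeStarCoercivityDefectFreeCrystallizesLayeredGluing02
import Summits.AtomisticToContinuum.Crystallization.Theorems.ReggeStarCoercivityDefectFreeCrystallizesLayeredGluing

/-!
# Line `Sketch` (idea card `exact-hull-rigidity`) for crux `PhononSlackCertificates.HullBridge`
# (item stmt-AtomisticToContinuum-15147) — LEAD'S SKELETON (reshaped onto tree vocabulary)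

Crux (by name, concluded by `HullBridge_of` below):
`Summit.AtomisticToContinuum.Crystallization.Theses.PhononSlackCertificates.HullBridge`
= `CoerciveTwoShellGap → NearFieldConvexity → (layered windows of every LJ ground-state sequence)`.

The line (card `Cruxes/HullBridge/Ideas/exact-hull-rigidity.md`): the only rigidity atom is the
potential-free GLUING LEMMA for the explicit box family (compactness in the local matching topology +
EXACT local-to-global rigidity of box-layered sets); everything else is counting and compactness in the
spacing. The gluing lemma is stated VERBATIM as the tree Prop
`Theorems.PrestressSplitKorn.LayeredGluing` (landed Defs file of the sibling crux 13603, line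
`prestress-split-korn`, whose proof files `…LayeredGluing01‥14/…LayeredGluing` are landing), so that the two
lines share one gluing theorem; the local predicate `LayeredNear η x i` of that file is verbatim the
`η`-layered predicate counted by `NearFieldConvexity`, and the sibling crux's goodness `PredicateAPI.Good`
follows from two-shell goodness by the landed `SeparationPaddingTransfer.stub_twoShellGoodStarGood`.

  S1 `stub_badFraction`        soft (S): `CoerciveTwoShellGap` + `E(N) − N e* = o(N)` (`squeeze_tendsto_excess_div`,
                               i.e. the PROVED `crysEnergyLimit`) + `1/3`-separation ⇒ `#(1/20-bad)/N → 0`.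
  S2 `stub_nonLayeredFraction` soft (M): `NearFieldConvexity` at fixed `η` with `Ω :=` the two-shell-good sites,
                               boundary `#∂₄Ω ≤ (8/δ+1)³·#bad`, site energies `≥ −(125/6)δ⁻⁶` on bad sites
                               ⇒ `#{¬ LayeredNear η}/N → 0` (the inline predicate of 13958 IS `LayeredNear`).
  S3 `stub_cleanCentres`       soft (S): packing (`squeeze_card_filter_exists_near_le`) ⇒ for all large `N` some
                               particle has every particle within `R'` two-shell-good (hence `Good`) and `η`-layered.
  S4 `stub_layeredGluing`      THE RIGIDITY ATOM (L): `PrestressSplitKorn.LayeredGluing` (shared with crux 13603). RESHAPED after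
                               wave 1 (the compactness half `layeredGluing_of_exactRigidity : ExactLayeredRigidity → LayeredGluing`
                               landed in the tree, …LayeredGluing02): S4 := that theorem applied to the new stub
  S4x `stub_exactLayeredRigidity` EXACT LOCAL-TO-GLOBAL RIGIDITY (L): the tree Prop `PrestressSplitKorn.ExactLayeredRigidity` — a nonempty
                               uniformly discrete set of ℝ³ exactly box-layered on every open 2-ball is ONE rigid image of ONE box
                               template (the card's `locallyLayered_rigidity`; LANDED by the sibling parts …LayeredGluing03‥14 + final,
                               `PrestressSplitKorn.exactLayeredRigidity_holds`, 2026-08-16 17:04Z) — the skeleton is now sorry-free.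
  S5 `stub_windowsOfGluing`    soft (S): gluing at the clean centre gives an `(R, ε)`-window of SOME spacing eventually;
                               compactness in the spacing (`hb_exists_global_spacing` with `hb_window_mono`, `hb_window_neg`,
                               `hb_window_rescale` of this item's landed part 1) gives ONE spacing for all scales frequently in `N`.

`composition` is pure logic; `HullBridge_of : HullBridge` feeds the five registered stubs into it (no sorry of its own).
-/

noncomputable section

open scoped BigOperators Classical
open Filter Topology

namespace Summit.AtomisticToContinuum.Crystallization.Cruxes.HullBridge.ExactHullRigidity

open Summit.AtomisticToContinuum.Crystallization.Theses.PhononSlackCertificates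
open Summit.AtomisticToContinuum.Crystallization.Theorems.PrestressSplitKorn
  (layeredPos InBox LayeredNear LayeredGluing ExactLayeredRigidity layeredGluing_of_exactRigidity)
open Summit.AtomisticToContinuum.Crystallization.Theorems.DefectFreeCrystallizes.Negative.PredicateAPI (Good)
open Literature.MathematicalPhysics.StatisticalMechanics Literature.Geometry.DiscreteGeometry

local notation "E3" => EuclideanSpace ℝ (Fin 3)

/-! ## Registered stubs (the only sorries of the file) -/

/-- S1 — the bad fraction vanishes: along LJ ground states, `CoerciveTwoShellGap` (at the separation `δ` of
`LennardJonesMinimalDistance_holds`) and the `o(N)` energy budget give `#{i : ¬ 1/20-good}/N → 0`. -/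
theorem stub_badFraction (hCG : CoerciveTwoShellGap) (x : (N : ℕ) → (Fin N → E3))
    (hx : ∀ N, IsGroundState lennardJones (x N)) :
    Tendsto (fun N : ℕ =>
      (Nat.card {i : Fin N // ¬ IsTwoShellGood (1 / 20) (47 / 50) 1 (x N) i} : ℝ) / N) atTop (𝓝 0) :=
  -- S1 LANDED (p96266): Theorems/PhononSlackCertificatesHullBridgeBadFraction.lean
  Summit.AtomisticToContinuum.Crystallization.Theorems.HullBridgeExact.stub_badFraction hCG x hx

/-- S2 — the non-layered fraction vanishes: `NearFieldConvexity` at fixed `η`, applied with `Ω :=` the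
two-shell-good sites of `x N`, gives `#{i : ¬ LayeredNear η (x N) i}/N → 0` once the bad fraction vanishes. -/
theorem stub_nonLayeredFraction (hNF : NearFieldConvexity) (x : (N : ℕ) → (Fin N → E3))
    (hx : ∀ N, IsGroundState lennardJones (x N))
    (hbad : Tendsto (fun N : ℕ =>
      (Nat.card {i : Fin N // ¬ IsTwoShellGood (1 / 20) (47 / 50) 1 (x N) i} : ℝ) / N) atTop (𝓝 0))
    {η : ℝ} (hη : 0 < η) :
    Tendsto (fun N : ℕ =>
      ((Finset.univ.filter fun i : Fin N => ¬ LayeredNear η (x N) i).card : ℝ) / N) atTop (𝓝 0) :=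
  -- S2 LANDED (p96827): Theorems/PhononSlackCertificatesHullBridgeNonLayeredFraction.lean
  Summit.AtomisticToContinuum.Crystallization.Theorems.HullBridgeExact.stub_nonLayeredFraction hNF x hx hbad hη

/-- S3 — clean centres: if the bad and the non-`η`-layered fractions vanish, then for every radius `R'`,
for all large `N`, some particle has every particle within `R'` of it `Good` (sibling-crux goodness, from
two-shell goodness by `stub_twoShellGoodStarGood`) and `η`-layered. -/
theorem stub_cleanCentres (x : (N : ℕ) → (Fin N → E3)) (hx : ∀ N, IsGroundState lennardJones (x N))
    (hbad : Tendsto (fun N : ℕ =>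
      (Nat.card {i : Fin N // ¬ IsTwoShellGood (1 / 20) (47 / 50) 1 (x N) i} : ℝ) / N) atTop (𝓝 0))
    (hnl : ∀ η : ℝ, 0 < η → Tendsto (fun N : ℕ =>
      ((Finset.univ.filter fun i : Fin N => ¬ LayeredNear η (x N) i).card : ℝ) / N) atTop (𝓝 0))
    {η : ℝ} (hη : 0 < η) (R' : ℝ) :
    ∀ᶠ N : ℕ in atTop, ∃ i : Fin N, ∀ j : Fin N, dist (x N j) (x N i) ≤ R' →
      Good (x N) j ∧ LayeredNear η (x N) j :=
  -- S3 LANDED (p96661): Theorems/PhononSlackCertificatesHullBridgeCleanCentres.lean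
  Summit.AtomisticToContinuum.Crystallization.Theorems.HullBridgeExact.stub_cleanCentres x hx hbad hnl hη R'

/-- S4x — EXACT LOCAL-TO-GLOBAL RIGIDITY OF BOX-LAYERED SETS (the line's rigidity atom after the reshape; the tree Prop
`PrestressSplitKorn.ExactLayeredRigidity` of `…LayeredGluingDefs`): a nonempty uniformly discrete `Y ⊆ ℝ³` every point of
which is EXACTLY box-layered on its open 2-ball (`ExactNear Y p`) is globally one rigid image of one box template. -/
theorem stub_exactLayeredRigidity : ExactLayeredRigidity :=
  -- S4x LANDED (sibling line prestress-split-korn, crux 13603): Theorems/ReggeStarCoercivityDefectFreeCrystallizesLayeredGluing.lean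
  Summit.AtomisticToContinuum.Crystallization.Theorems.PrestressSplitKorn.exactLayeredRigidity_holds

/-- S4 — THE GLUING LEMMA (the line's rigidity atom; verbatim the tree Prop of the sibling line
`prestress-split-korn`, crux 13603, whose proof is landing as `Theorems.PrestressSplitKorn.stub_layeredGluing`). -/
theorem stub_layeredGluing : LayeredGluing :=
  -- compactness half LANDED in the tree (sibling line, …LayeredGluing02): `layeredGluing_of_exactRigidity`
  layeredGluing_of_exactRigidity stub_exactLayeredRigidity

/-- S5 — windows from gluing: clean centres at every `(η, R')` plus the gluing lemma give, per sequence, ONE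
in-layer spacing `a ∈ [47/50, 1]` and `(R, ε)`-windows frequently in `N` for every scale (the conclusion of
`HullBridge` for that sequence). -/
theorem stub_windowsOfGluing (hG : LayeredGluing) (x : (N : ℕ) → (Fin N → E3))
    (hx : ∀ N, IsGroundState lennardJones (x N))
    (hcentre : ∀ η : ℝ, 0 < η → ∀ R' : ℝ, ∀ᶠ N : ℕ in atTop, ∃ i : Fin N, ∀ j : Fin N,
      dist (x N j) (x N i) ≤ R' → Good (x N) j ∧ LayeredNear η (x N) j) :
    ∃ a : ℝ, 47 / 50 ≤ a ∧ a ≤ 1 ∧ ∀ R ε : ℝ, 0 < ε → ∃ᶠ N in Filter.atTop,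
      ∃ (A : E3 →ₗᵢ[ℝ] E3) (t : E3) (s : ℤ → ℤ) (z : ℤ → ℝ), IsHaggSeq s ∧
        (∀ m : ℤ, 39 / 50 * a ≤ z (m + 1) - z m ∧ z (m + 1) - z m ≤ 17 / 20 * a) ∧
        let S : Set E3 := {p | ∃ m i j : ℤ, p = A (((i : ℝ) • triangularVec₁ a) +
          ((j : ℝ) • triangularVec₂ a) + ((haggLabel s m : ℝ) • barlowOffset a) + (z m • layerNormal 1))}
        (∀ p ∈ S, ‖p‖ ≤ R → ∃ i : Fin N, dist (x N i + t) p ≤ ε) ∧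
          (∀ i : Fin N, ‖x N i + t‖ ≤ R → ∃ p ∈ S, dist (x N i + t) p ≤ ε) :=
  -- S5 LANDED (p97092): Theorems/PhononSlackCertificatesHullBridgeWindowsOfGluing.lean
  Summit.AtomisticToContinuum.Crystallization.Theorems.HullBridgeExact.stub_windowsOfGluing hG x hx hcentre

/-! ## The kernel-checked composition -/

/-- **Pure logic of the line** (no sorry, no stub used): S1, S2, S3 feed S5 through S4; the conclusion is the
matrix of `HullBridge` (spelled out, so that this documentation theorem is not itself a by-name candidate). -/
theorem composition
    (h1 : ∀ (_ : CoerciveTwoShellGap) (x : (N : ℕ) → (Fin N → E3)), (∀ N, IsGroundState lennardJones (x N)) →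
      Tendsto (fun N : ℕ =>
        (Nat.card {i : Fin N // ¬ IsTwoShellGood (1 / 20) (47 / 50) 1 (x N) i} : ℝ) / N) atTop (𝓝 0))
    (h2 : ∀ (_ : NearFieldConvexity) (x : (N : ℕ) → (Fin N → E3)), (∀ N, IsGroundState lennardJones (x N)) →
      Tendsto (fun N : ℕ =>
        (Nat.card {i : Fin N // ¬ IsTwoShellGood (1 / 20) (47 / 50) 1 (x N) i} : ℝ) / N) atTop (𝓝 0) →
      ∀ η : ℝ, 0 < η → Tendsto (fun N : ℕ =>
        ((Finset.univ.filter fun i : Fin N => ¬ LayeredNear η (x N) i).card : ℝ) / N) atTop (𝓝 0))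
    (h3 : ∀ (x : (N : ℕ) → (Fin N → E3)), (∀ N, IsGroundState lennardJones (x N)) →
      Tendsto (fun N : ℕ =>
        (Nat.card {i : Fin N // ¬ IsTwoShellGood (1 / 20) (47 / 50) 1 (x N) i} : ℝ) / N) atTop (𝓝 0) →
      (∀ η : ℝ, 0 < η → Tendsto (fun N : ℕ =>
        ((Finset.univ.filter fun i : Fin N => ¬ LayeredNear η (x N) i).card : ℝ) / N) atTop (𝓝 0)) →
      ∀ η : ℝ, 0 < η → ∀ R' : ℝ, ∀ᶠ N : ℕ in atTop, ∃ i : Fin N, ∀ j : Fin N,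
        dist (x N j) (x N i) ≤ R' → Good (x N) j ∧ LayeredNear η (x N) j)
    (h4 : LayeredGluing)
    (h5 : LayeredGluing → ∀ (x : (N : ℕ) → (Fin N → E3)), (∀ N, IsGroundState lennardJones (x N)) →
      (∀ η : ℝ, 0 < η → ∀ R' : ℝ, ∀ᶠ N : ℕ in atTop, ∃ i : Fin N, ∀ j : Fin N,
        dist (x N j) (x N i) ≤ R' → Good (x N) j ∧ LayeredNear η (x N) j) →
      ∃ a : ℝ, 47 / 50 ≤ a ∧ a ≤ 1 ∧ ∀ R ε : ℝ, 0 < ε → ∃ᶠ N in Filter.atTop,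
        ∃ (A : E3 →ₗᵢ[ℝ] E3) (t : E3) (s : ℤ → ℤ) (z : ℤ → ℝ), IsHaggSeq s ∧
          (∀ m : ℤ, 39 / 50 * a ≤ z (m + 1) - z m ∧ z (m + 1) - z m ≤ 17 / 20 * a) ∧
          let S : Set E3 := {p | ∃ m i j : ℤ, p = A (((i : ℝ) • triangularVec₁ a) +
            ((j : ℝ) • triangularVec₂ a) + ((haggLabel s m : ℝ) • barlowOffset a) + (z m • layerNormal 1))}
          (∀ p ∈ S, ‖p‖ ≤ R → ∃ i : Fin N, dist (x N i + t) p ≤ ε) ∧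
            (∀ i : Fin N, ‖x N i + t‖ ≤ R → ∃ p ∈ S, dist (x N i + t) p ≤ ε)) :
    CoerciveTwoShellGap → NearFieldConvexity → ∀ x : (N : ℕ) → (Fin N → E3),
      (∀ N, IsGroundState lennardJones (x N)) →
      ∃ a : ℝ, 47 / 50 ≤ a ∧ a ≤ 1 ∧ ∀ R ε : ℝ, 0 < ε → ∃ᶠ N in Filter.atTop,
        ∃ (A : E3 →ₗᵢ[ℝ] E3) (t : E3) (s : ℤ → ℤ) (z : ℤ → ℝ), IsHaggSeq s ∧
          (∀ m : ℤ, 39 / 50 * a ≤ z (m + 1) - z m ∧ z (m + 1) - z m ≤ 17 / 20 * a) ∧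
          let S : Set E3 := {p | ∃ m i j : ℤ, p = A (((i : ℝ) • triangularVec₁ a) +
            ((j : ℝ) • triangularVec₂ a) + ((haggLabel s m : ℝ) • barlowOffset a) + (z m • layerNormal 1))}
          (∀ p ∈ S, ‖p‖ ≤ R → ∃ i : Fin N, dist (x N i + t) p ≤ ε) ∧
            (∀ i : Fin N, ‖x N i + t‖ ≤ R → ∃ p ∈ S, dist (x N i + t) p ≤ ε) := by
  intro hCG hNF x hx
  have hbad := h1 hCG x hx
  exact h5 h4 x hx (h3 x hx hbad (h2 hNF x hx hbad))

/-- **The line concludes the crux BY NAME.** The five registered stubs fed into `composition`; no sorry of its own. -/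
theorem HullBridge_of :
    Summit.AtomisticToContinuum.Crystallization.Theses.PhononSlackCertificates.HullBridge :=
  composition stub_badFraction stub_nonLayeredFraction stub_cleanCentres stub_layeredGluing
    stub_windowsOfGluing

end Summit.AtomisticToContinuum.Crystallization.Cruxes.HullBridge.ExactHullRigidity

end
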